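import Literature.AlgebraicGeometry.HodgeTheory.HodgeGenericQbarDescent
import Literature.AlgebraicGeometry.HodgeTheory.DirectImageTransport
import Literature.AlgebraicGeometry.HodgeTheory.MotivatedClassesDeformationInputs
import Literature.AlgebraicGeometry.HodgeTheory.LefschetzOneOneProofs
import Literature.AlgebraicGeometry.Motives.GeometricallyIntegralAlgClosed
import Literature.AlgebraicGeometry.Motives.BaseChangeProofs
import Literature.AlgebraicGeometry.Motives.AbelianVarietyProofs
import Literature.NumberTheory.Transcendental.AnalytificationConnectedProofs
import HarnessLib

/-!
# The complexification of a smooth irreducible quasi-projective base, and the local system of a `ℚ̄`-family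

Family `hodge`, layer `Literature/AlgebraicGeometry/HodgeTheory` (fact seat of
`bku_finite_monodromyOrbit_of_isHodgeGenericIn`). The two named facts of `HodgeGenericQbarDescent`
(`bku_finite_monodromyOrbit_of_isHodgeGenericIn`, `voisin2007_algebraic_of_finite_monodromyOrbit_of_qbar`)
are stated for a family `f = f₀ ⊗_σ ℂ : 𝒳 ⟶ S`, `σ : ℚ̄ →+* ℂ`, whose base `S = S₀ ⊗_σ ℂ` is the
complexification of a SMOOTH, IRREDUCIBLE, QUASI-PROJECTIVE `ℚ̄`-scheme `S₀` (hypotheses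
`IsQuasiProjectiveOver S₀`, `IrreducibleSpace S₀.left`, `Smooth S₀.hom`), whereas the tree's theorems
on the local system `Rᵏ f_* ℂ` on the real carriers (`isCohomologicallyLocallyTrivialOn_univ_of_isSmoothProjectiveFamily`,
`transportFun`, the bricks of `HodgeGenericQbarDescentProofs`) ask for a quasi-projective base SMOOTH OF
PURE DIMENSION `d` over `ℂ` (and, for the identity principle, `S(ℂ)` connected). This file PROVES the
passage from the former to the latter — standard scheme theory, assembled from the tree — after a
first section valid for any base `S` over `ℂ`: **the rational and the integral structure of
`Rᵏ f_* ℂ` are flat** (`IsHomotopicallyLocallyTrivialOn.isRationalClass_transportFun`,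
`IsHomotopicallyLocallyTrivialOn.isIntegralClass_transportFun`: over small tubes retracting onto their
fibres — Ehresmann — a tube class with rational, resp. integral, restriction to one fibre is rational,
resp. integral, so the continuation principle `transportFun_prop` applies; Voisin I Rem. 10.17,
Voisin II §3.1.2), with hypothesis-free forms for smooth proper / smooth projective families
(`isRationalClass_transportFun_univ`, `isIntegralClass_transportFun_univ`, `…_of_isSmoothProjectiveFamily`).
Then:

* `smooth_baseChangeHom_hom` — smoothness is stable under extension of the base field along
  `σ : k →+* L` (Mathlib `smooth_isStableUnderBaseChange`; quasi-projectivity and smoothness of a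
  given relative dimension likewise — `HodgeGenericQbarDescentProofs`, private copies here);
* `irreducibleSpace_baseChangeHom_left` — for `k` ALGEBRAICALLY CLOSED, a smooth irreducible
  `k`-scheme stays irreducible after base change to any field `L`: smooth over a field ⇒ reduced
  (Stacks 056T, the tree's `Motives.isReduced_of_smooth_over_field`), integral over `k = k̄` ⇒
  geometrically integral (Görtz–Wedhorn I Prop. 5.51, the tree's
  `Motives.geometricallyIntegral_of_isAlgClosed`), hence `X_L` is (geometrically) irreducible;
* `connectedSpace_complexPoints_baseChangeHom` — hence, for `L = ℂ` and `X` quasi-projective,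
  `X_σ(ℂ)` is CONNECTED in the analytic topology (irreducible varieties are connected, SGA1 XII
  Prop. 2.4, the tree's PROVED `Motives.ComplexPoints.isConnected_setOf_pt_mem_of_isIrreducible_holds`);
* `exists_smoothOfRelativeDimension_baseChangeHom` — and `X_σ` is smooth of ONE relative dimension
  `d` (an irreducible smooth scheme has a single relative dimension, Görtz–Wedhorn Thm. 6.28, the
  tree's `Motives.exists_smoothOfRelativeDimension_of_smooth`; then base change).

Consequences for a `ℚ̄`-family (any field `k`, `σ : k →+* ℂ`, `f₀ : 𝒳₀ ⟶ S₀` with smooth projective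
complexification over such an `S₀`) — the hypotheses shape of the two named facts:

* `isCohomologicallyLocallyTrivialOn_univ_baseChangeHom` — **`Rᵏ f_* ℂ` is a local system on
  `S(ℂ)`** (Ehresmann's theorem on complex points, `isCohomologicallyLocallyTrivialOn_univ_of_isSmoothProjectiveFamily`)
  — the hypothesis `hU` of `transportFun f k hU` and of the orbit theorems of
  `HodgeGenericQbarDescentProofs` (`finite_setOf_isContinuationAlong_of_finiteIndex`: the monodromy
  orbit of a class fixed under transport by a finite-index subgroup of `π₁(S(ℂ), s)` is finite — the
  formal last step of the printed proof of `bku_finite_monodromyOrbit_of_isHodgeGenericIn`,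
  Baldi–Klingler–Ullmo §3.2 with André 1992), now available for exactly the families of that fact;
  `pathConnectedSpace_complexPoints_baseChangeHom`. What a proof of that fact still needs is the
  Hodge-theoretic production of the finite-index subgroup (holomorphic variation of the Hodge
  filtration, analyticity of Hodge loci, a flat polarization on the real carriers) — not in the tree.
* Sections `Orbit`, `QbarOrbit` (with private copies of the orbit lemmas of
  `HodgeGenericQbarDescentProofs`, which is not imported): **the monodromy orbit of a
  rational (integral) class consists of rational (integral) classes**
  (`IsContinuationAlong.isRationalClass_of_isSmoothProjectiveFamily`, `….isIntegralClass_…`,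
  `IsContinuationAlong.isRationalClass_baseChangeHom`, `….isIntegralClass_baseChangeHom`), and
  `finite_setOf_isContinuationAlong_of_finiteIndex_baseChangeHom` — the finite-orbit conclusion of
  `bku_finite_monodromyOrbit_of_isHodgeGenericIn` from a finite-index fixing subgroup, in exactly the
  hypotheses shape of that fact.

Everything is a theorem; no definition and no named fact is introduced (D-0026).

## References

* [Liu2002] Q. Liu, Algebraic Geometry and Arithmetic Curves, OUP 2002, Prop. 3.1.23, Ex. 3.1.10.
* [StacksProject] The Stacks Project, Tag 056T (smooth over a field ⇒ geometrically reduced),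
  Tag 020J / 0366 (integral over an algebraically closed field ⇒ geometrically integral).
* [GortzWedhorn2020] U. Görtz, T. Wedhorn, Algebraic Geometry I, 2nd ed. (2020), Prop. 5.51,
  Cor. 5.54, Thm. 6.28.
* [SGA1] A. Grothendieck, M. Raynaud, SGA 1, Exp. XII Prop. 2.4.
* [VoisinHodgeI2002] C. Voisin, Hodge Theory and Complex Algebraic Geometry I, CUP 2002, Thm. 9.3,
  §9.2.1, Rem. 10.17.
* [VoisinHodgeII2003] C. Voisin, Hodge Theory and Complex Algebraic Geometry II, CUP 2003, §3.1.2.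
* [HatcherAT2002] A. Hatcher, Algebraic Topology, CUP 2002, §3.1.
* [BaldiKlinglerUllmo2024] G. Baldi, B. Klingler, E. Ullmo, Invent. Math. 235 (2024), §3.2.
-/

noncomputable section

open CategoryTheory CategoryTheory.Limits AlgebraicGeometry
open _root_.Topology
open Literature.AlgebraicTopology.SingularHomology

universe u

namespace Literature.AlgebraicGeometry.HodgeTheory

section HodgeTheory

/-! ### The rational and integral structures of `Rᵏ f_* ℂ` are flat -/

section Flat

variable {𝒳 S : Motives.SchemeOver ℂ} (f : 𝒳 ⟶ S) (k : ℕ) {U : Set (Motives.ComplexPoints S)}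

/-- Over a tube retracting onto the fibre `X_s(ℂ)`, a tube class whose restriction to `X_s(ℂ)` is
INTEGRAL is integral (pull back along the homotopy inverse; the `ℤ`-analogue of
`isRationalClass_of_homotopyEquiv`). A private copy of the lemma of the same name of
`UniversalHypersurfaceHodgeLoci` (kept private to avoid that file's import cone).
[cite: HatcherAT2002, §3.1 p. 201] -/
private theorem isIntegralClass_of_homotopyEquiv' {B : Set (Motives.ComplexPoints S)}
    {s : Motives.ComplexPoints S} (hs : s ∈ B)
    (e : ContinuousMap.HomotopyEquiv (Motives.ComplexPoints (Motives.fiberOver f s)) (tubeOver f B))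
    (he : e.toFun = fiberToTube f hs) {j : ℕ} (ξ : singularCohomology ℂ ℂ (tubeOver f B) j)
    (hξ : IsIntegralClass (fiberRestrict f hs j ξ)) : IsIntegralClass ξ := by
  have h : singularCohomology.map ℂ ℂ e.invFun j (fiberRestrict f hs j ξ) = ξ := by
    rw [fiberRestrict, ← he, ← ModuleCat.comp_apply, ← singularCohomology.map_comp,
      singularCohomology.map_eq_of_homotopic' ℂ ℂ e.right_inv, singularCohomology.map_id]
    rfl
  rw [← h]
  exact hξ.map _

/-- **Transport preserves rational classes** when `f` is homotopically locally trivial over `U`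
(every point has small open tubes retracting onto their fibres — Ehresmann): the rational-descent
hypothesis of `isRationalClass_transportFun` holds over such tubes (`isRationalClass_of_homotopyEquiv`),
so `γ_* α` is rational for `α ∈ Hᵏ(X_s(ℂ); ℚ)` — the local system `Rᵏ f_* ℚ ⊂ Rᵏ f_* ℂ`
(Voisin II §3.1.2; Voisin I §7.1.1 "the rational structure is flat").
[cite: VoisinHodgeII2003, §3.1.2] [cite: VoisinHodgeI2002, Thm. 9.3 and §9.2.1] -/
theorem IsHomotopicallyLocallyTrivialOn.isRationalClass_transportFun
    (hU : IsHomotopicallyLocallyTrivialOn f U) {s t : U} (γ : Path.Homotopic.Quotient s t)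
    {α : complexBetti (Motives.fiberOver f s.1) k} (hα : IsRationalClass α) :
    IsRationalClass (transportFun f k hU.isCohomologicallyLocallyTrivialOn γ α) := by
  refine Literature.AlgebraicGeometry.HodgeTheory.isRationalClass_transportFun f k _
    (fun t ht ↦ ?_) γ hα
  obtain ⟨B, hBo, htB, -, hBU, he⟩ := hU.exists_nhds_homotopyEquiv ht Set.univ Filter.univ_mem
  refine ⟨B, hBo, htB, hBU, fun j s hs ↦ ?_, fun j s hs ξ hξ ↦ ?_⟩
  · obtain ⟨e, he⟩ := he hs
    exact (IsSpecialisingNhd.of_homotopyEquiv hBo hs e he j).bijective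
  · obtain ⟨e, he⟩ := he hs
    exact isRationalClass_of_homotopyEquiv f hs e he ξ hξ

/-- **Transport preserves integral classes** when `f` is homotopically locally trivial over `U`:
the local system `Rᵏ f_* ℤ/tors ⊂ Rᵏ f_* ℂ` ("the integral structure … is flat", Voisin I
Rem. 10.17), by the continuation principle `transportFun_prop` and integral descent over retracting
tubes (the `ℤ`-analogue of `isRationalClass_of_homotopyEquiv`). [cite: VoisinHodgeI2002, Rem. 10.17 and §9.2.1] -/
theorem IsHomotopicallyLocallyTrivialOn.isIntegralClass_transportFun
    (hU : IsHomotopicallyLocallyTrivialOn f U) {s t : U} (γ : Path.Homotopic.Quotient s t)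
    {α : complexBetti (Motives.fiberOver f s.1) k} (hα : IsIntegralClass α) :
    IsIntegralClass (transportFun f k hU.isCohomologicallyLocallyTrivialOn γ α) := by
  refine transportFun_prop f k _ (fun _ x ↦ IsIntegralClass x) (fun t ht ↦ ?_) γ hα
  obtain ⟨B, hBo, htB, -, hBU, he⟩ := hU.exists_nhds_homotopyEquiv ht Set.univ Filter.univ_mem
  refine ⟨B, hBo, htB, hBU, fun j s hs ↦ ?_, fun ξ s s' hs hs' h ↦ ?_⟩
  · obtain ⟨e, he⟩ := he hs
    exact (IsSpecialisingNhd.of_homotopyEquiv hBo hs e he j).bijective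
  · obtain ⟨e, he⟩ := he hs
    exact (isIntegralClass_of_homotopyEquiv' f hs e he ξ h).map (fiberToTube f hs')

/-- **`Rᵏ f_* ℚ` is a sub-local system of `Rᵏ f_* ℂ` for a smooth proper family over a smooth base**:
with the instances of `isCohomologicallyLocallyTrivialOn_univ` (Ehresmann on complex points),
transport over `S(ℂ)` carries rational classes to rational classes. [cite: VoisinHodgeII2003, §3.1.2] -/
theorem isRationalClass_transportFun_univ (d m : ℕ)
    [SmoothOfRelativeDimension d f.left] [IsProper f.left] [SmoothOfRelativeDimension m S.hom]
    [LocallyOfFiniteType S.hom] [IsSeparated S.hom] [CompactSpace S.left]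
    {s t : (Set.univ : Set (Motives.ComplexPoints S))} (γ : Path.Homotopic.Quotient s t)
    {α : complexBetti (Motives.fiberOver f s.1) k} (hα : IsRationalClass α) :
    IsRationalClass (transportFun f k (isCohomologicallyLocallyTrivialOn_univ f d m) γ α) :=
  (isHomotopicallyLocallyTrivialOn_univ f d m).isRationalClass_transportFun f k γ hα

/-- **`Rᵏ f_* ℤ/tors` is a sub-local system of `Rᵏ f_* ℂ` for a smooth proper family over a smooth
base**: transport over `S(ℂ)` carries integral classes to integral classes. [cite: VoisinHodgeI2002, Rem. 10.17] -/
theorem isIntegralClass_transportFun_univ (d m : ℕ)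
    [SmoothOfRelativeDimension d f.left] [IsProper f.left] [SmoothOfRelativeDimension m S.hom]
    [LocallyOfFiniteType S.hom] [IsSeparated S.hom] [CompactSpace S.left]
    {s t : (Set.univ : Set (Motives.ComplexPoints S))} (γ : Path.Homotopic.Quotient s t)
    {α : complexBetti (Motives.fiberOver f s.1) k} (hα : IsIntegralClass α) :
    IsIntegralClass (transportFun f k (isCohomologicallyLocallyTrivialOn_univ f d m) γ α) :=
  (isHomotopicallyLocallyTrivialOn_univ f d m).isIntegralClass_transportFun f k γ hα

/-- The same for a smooth projective family over a quasi-projective base smooth of pure dimension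
`d` (the hypothesis shape of `isCohomologicallyLocallyTrivialOn_univ_of_isSmoothProjectiveFamily`):
transport carries rational classes to rational classes. [cite: VoisinHodgeII2003, §3.1.2] -/
theorem isRationalClass_transportFun_of_isSmoothProjectiveFamily {n : ℕ} (d : ℕ)
    (hf : Motives.IsSmoothProjectiveFamily f n) (hS : IsQuasiProjectiveOver S)
    [SmoothOfRelativeDimension d S.hom]
    {s t : (Set.univ : Set (Motives.ComplexPoints S))} (γ : Path.Homotopic.Quotient s t)
    {α : complexBetti (Motives.fiberOver f s.1) k} (hα : IsRationalClass α) :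
    IsRationalClass (transportFun f k
      (isCohomologicallyLocallyTrivialOn_univ_of_isSmoothProjectiveFamily f d hf hS) γ α) := by
  haveI : LocallyOfFiniteType S.hom := hS.locallyOfFiniteType
  haveI : IsSeparated S.hom := hS.isVarietyPair_ofScheme.isSeparated
  haveI : QuasiCompact S.hom := hS.isVarietyPair_ofScheme.quasiCompact
  haveI : CompactSpace S.left := QuasiCompact.compactSpace_of_compactSpace S.hom
  haveI := hf.smoothOfRelativeDimension
  haveI := hf.isProper
  exact (isHomotopicallyLocallyTrivialOn_univ f n d).isRationalClass_transportFun f k γ hα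

/-- The same for integral classes. [cite: VoisinHodgeI2002, Rem. 10.17] -/
theorem isIntegralClass_transportFun_of_isSmoothProjectiveFamily {n : ℕ} (d : ℕ)
    (hf : Motives.IsSmoothProjectiveFamily f n) (hS : IsQuasiProjectiveOver S)
    [SmoothOfRelativeDimension d S.hom]
    {s t : (Set.univ : Set (Motives.ComplexPoints S))} (γ : Path.Homotopic.Quotient s t)
    {α : complexBetti (Motives.fiberOver f s.1) k} (hα : IsIntegralClass α) :
    IsIntegralClass (transportFun f k
      (isCohomologicallyLocallyTrivialOn_univ_of_isSmoothProjectiveFamily f d hf hS) γ α) := by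
  haveI : LocallyOfFiniteType S.hom := hS.locallyOfFiniteType
  haveI : IsSeparated S.hom := hS.isVarietyPair_ofScheme.isSeparated
  haveI : QuasiCompact S.hom := hS.isVarietyPair_ofScheme.quasiCompact
  haveI : CompactSpace S.left := QuasiCompact.compactSpace_of_compactSpace S.hom
  haveI := hf.smoothOfRelativeDimension
  haveI := hf.isProper
  exact (isHomotopicallyLocallyTrivialOn_univ f n d).isIntegralClass_transportFun f k γ hα

end Flat

/-! ### Base change of smoothness and irreducibility along `σ : k →+* L` -/

section BaseChange

variable {k L : Type u} [Field k] [Field L] (σ : k →+* L)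

/-- Quasi-projectivity is stable under extension of the base field along `σ : k →+* L` (open
immersions and projectivity base-change; Liu 2002 Prop. 3.1.23). A private copy of
`IsQuasiProjectiveOver.baseChangeHom` of `HodgeGenericQbarDescentProofs`, kept here so that this file
only depends on the stable part of that (concurrently extended) file. [cite: Liu2002, Prop. 3.1.23 and Rem. 3.1.20] -/
private theorem isQuasiProjectiveOver_baseChangeHom' {X : Motives.SchemeOver k}
    (h : IsQuasiProjectiveOver X) : IsQuasiProjectiveOver ((Motives.baseChangeHom σ).obj X) := by
  obtain ⟨P, j, hP, hj⟩ := h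
  letI := σ.toAlgebra
  refine ⟨(Motives.baseChangeHom σ).obj P, (Motives.baseChangeHom σ).map j, hP.baseChange_obj L, ?_⟩
  exact MorphismProperty.IsStableUnderBaseChange.of_isPullback
    (Motives.isPullback_baseChange_map_left L j).flip hj

/-- Smoothness of relative dimension `d` is stable under base change along `σ` (Mathlib
`smoothOfRelativeDimension_isStableUnderBaseChange`; private copy, same reason).
[cite: Liu2002, Prop. 4.3.38] -/
private theorem smoothOfRelativeDimension_baseChangeHom_hom' (d : ℕ) (X : Motives.SchemeOver k)
    [h : SmoothOfRelativeDimension d X.hom] :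
    SmoothOfRelativeDimension d ((Motives.baseChangeHom σ).obj X).hom :=
  have := smoothOfRelativeDimension_isStableUnderBaseChange d
  MorphismProperty.pullback_snd (P := @SmoothOfRelativeDimension d) _ _ h

/-- **Smoothness is stable under extension of the base field**: if `X → Spec k` is smooth, so is
`X_σ → Spec L` (Mathlib `smooth_isStableUnderBaseChange`; Hartshorne III Prop. 10.1(b)).
[cite: StacksProject, Tag 01VB] -/
theorem smooth_baseChangeHom_hom {X : Motives.SchemeOver k} [Smooth X.hom] :
    Smooth ((Motives.baseChangeHom σ).obj X).hom :=
  MorphismProperty.pullback_snd (P := @Smooth) _ _ ‹Smooth X.hom›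

/-- **A smooth irreducible scheme over an algebraically closed field stays irreducible after any
extension of the base field.** Smooth over a field ⇒ reduced (Stacks 056T,
`Motives.isReduced_of_smooth_over_field`), so `X` is integral; integral over `k = k̄` ⇒ geometrically
integral (Görtz–Wedhorn I Prop. 5.51 / Stacks 020J, `Motives.geometricallyIntegral_of_isAlgClosed`);
hence `X_σ → Spec L` is geometrically irreducible and `X_σ` is irreducible (`Spec L` is a point).
[cite: GortzWedhorn2020, Prop. 5.51 and Cor. 5.54] [cite: StacksProject, Tag 056T] -/
theorem irreducibleSpace_baseChangeHom_left [IsAlgClosed k] {X : Motives.SchemeOver k} [Smooth X.hom]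
    [IrreducibleSpace X.left] : IrreducibleSpace ((Motives.baseChangeHom σ).obj X).left := by
  haveI : IsReduced X.left := Motives.isReduced_of_smooth_over_field X.hom
  haveI : IsIntegral X.left := isIntegral_of_irreducibleSpace_of_isReduced X.left
  haveI : GeometricallyIntegral X.hom := Motives.geometricallyIntegral_of_isAlgClosed X.hom
  haveI : GeometricallyIrreducible ((Motives.baseChangeHom σ).obj X).hom :=
    inferInstanceAs (GeometricallyIrreducible (pullback.snd X.hom (Spec.map (CommRingCat.ofHom σ))))
  exact GeometricallyIrreducible.irreducibleSpace_of_subsingleton ((Motives.baseChangeHom σ).obj X).hom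

/-- **The complexification of a smooth irreducible `k`-scheme is smooth of ONE relative dimension**:
an irreducible smooth `k`-scheme is smooth of a single relative dimension `d` (the relative dimension
is locally constant and any two non-empty opens meet; the tree's
`Motives.exists_smoothOfRelativeDimension_of_smooth`, Görtz–Wedhorn Thm. 6.28), and smoothness of
relative dimension `d` is stable under base change (`smoothOfRelativeDimension_baseChangeHom_hom`).
[cite: GortzWedhorn2020, Thm. 6.28] -/
theorem exists_smoothOfRelativeDimension_baseChangeHom (X : Motives.SchemeOver k) [Smooth X.hom]
    [IrreducibleSpace X.left] :
    ∃ d : ℕ, SmoothOfRelativeDimension d ((Motives.baseChangeHom σ).obj X).hom := by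
  obtain ⟨d, hd⟩ := Motives.exists_smoothOfRelativeDimension_of_smooth X.hom
  haveI := hd
  exact ⟨d, smoothOfRelativeDimension_baseChangeHom_hom' σ d X⟩

end BaseChange

/-! ### Complex points of the complexification: connected, and the base is equidimensional -/

section Complex

variable {k : Type} [Field k] [IsAlgClosed k] (σ : k →+* ℂ)

/-- **The complex points of the complexification of a smooth irreducible quasi-projective
`k`-scheme, `k` algebraically closed, form a CONNECTED space** (analytic topology): `X_σ` is
irreducible (`irreducibleSpace_baseChangeHom_left`) and locally of finite type over `ℂ`, and
irreducible complex varieties are connected in the complex topology (SGA1 XII Prop. 2.4;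
Shafarevich VII §2 Thm. 7.1 — the tree's proved
`Motives.ComplexPoints.isConnected_setOf_pt_mem_of_isIrreducible_holds`). [cite: SGA1, Exp. XII Prop. 2.4] -/
theorem connectedSpace_complexPoints_baseChangeHom {X : Motives.SchemeOver k} [Smooth X.hom]
    [IrreducibleSpace X.left] (hX : IsQuasiProjectiveOver X) :
    ConnectedSpace (Motives.ComplexPoints ((Motives.baseChangeHom σ).obj X)) := by
  haveI : LocallyOfFiniteType ((Motives.baseChangeHom σ).obj X).hom :=
    (isQuasiProjectiveOver_baseChangeHom' σ hX).locallyOfFiniteType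
  haveI : IrreducibleSpace ((Motives.baseChangeHom σ).obj X).left :=
    irreducibleSpace_baseChangeHom_left σ
  have h := Motives.ComplexPoints.isConnected_setOf_pt_mem_of_isIrreducible_holds
    ((Motives.baseChangeHom σ).obj X) isClosed_univ
    (IrreducibleSpace.isIrreducible_univ (X := ↥((Motives.baseChangeHom σ).obj X).left))
  rw [connectedSpace_iff_univ]
  convert h using 1
  ext P
  simp

/-- The complex points of such a complexification form a path-connected space (a connected
topological manifold). [folklore] -/
theorem pathConnectedSpace_complexPoints_baseChangeHom {X : Motives.SchemeOver k} [Smooth X.hom]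
    [IrreducibleSpace X.left] (hX : IsQuasiProjectiveOver X) :
    PathConnectedSpace (Motives.ComplexPoints ((Motives.baseChangeHom σ).obj X)) := by
  obtain ⟨d, hd⟩ := exists_smoothOfRelativeDimension_baseChangeHom σ X
  haveI := hd
  haveI : LocallyOfFiniteType ((Motives.baseChangeHom σ).obj X).hom :=
    (isQuasiProjectiveOver_baseChangeHom' σ hX).locallyOfFiniteType
  haveI := connectedSpace_complexPoints_baseChangeHom σ hX
  exact pathConnectedSpace_complexPoints_of_smoothOfRelativeDimension _ d

end Complex

/-! ### The local system of a `ℚ̄`-family and its monodromy orbits -/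

section Family

variable {k : Type} [Field k] (σ : k →+* ℂ)
  {𝒳₀ S₀ : Motives.SchemeOver k} (f₀ : 𝒳₀ ⟶ S₀) {n : ℕ} (p : ℕ)

/-- **`Rᵏ f_* ℂ` is a local system on `S(ℂ)` for the complexification `f = f₀ ⊗_σ ℂ` of a family
over a smooth irreducible quasi-projective `S₀`**, `k` algebraically closed (e.g. `k = ℚ̄`), as soon
as `f` is a smooth projective family: `f` is cohomologically locally trivial by restriction over all
of `S(ℂ)` (Ehresmann's theorem on complex points over the equidimensional base `S₀ ⊗_σ ℂ`,
`isCohomologicallyLocallyTrivialOn_univ_of_isSmoothProjectiveFamily`). This is the hypothesis `hU`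
of the transport `transportFun f p hU` and of the bricks of `HodgeGenericQbarDescentProofs`, for
exactly the families of the named facts of `HodgeGenericQbarDescent`.
[cite: VoisinHodgeI2002, Thm. 9.3 and §9.2.1] -/
theorem isCohomologicallyLocallyTrivialOn_univ_baseChangeHom
    (hf : Motives.IsSmoothProjectiveFamily ((Motives.baseChangeHom σ).map f₀) n)
    (hS₀ : IsQuasiProjectiveOver S₀) [IrreducibleSpace S₀.left] [Smooth S₀.hom] :
    IsCohomologicallyLocallyTrivialOn ((Motives.baseChangeHom σ).map f₀)
      (Set.univ : Set (Motives.ComplexPoints ((Motives.baseChangeHom σ).obj S₀))) := by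
  obtain ⟨d, hd⟩ := exists_smoothOfRelativeDimension_baseChangeHom σ S₀
  haveI := hd
  exact isCohomologicallyLocallyTrivialOn_univ_of_isSmoothProjectiveFamily _ d hf (isQuasiProjectiveOver_baseChangeHom' σ hS₀)

end Family

/-! ### Monodromy orbits of rational and integral classes, and finite orbits from finite-index stabilisers -/

section Orbit

variable {𝒳 S : Motives.SchemeOver ℂ} (f : 𝒳 ⟶ S) (k : ℕ)

/-- Continuation along a path is transport (private copy of
`isContinuationAlong_iff_transportFun_eq` of `HodgeGenericQbarDescentProofs`, kept here so that this
file does not import that concurrently rewritten file). [cite: VoisinHodgeI2002, §9.2.1] -/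
private theorem isContinuationAlong_iff_transportFun_eq'
    (hU : IsCohomologicallyLocallyTrivialOn f (Set.univ : Set (Motives.ComplexPoints S)))
    {s t : Motives.ComplexPoints S} (γ : Path s t) (α : complexBetti (Motives.fiberOver f s) k)
    (β : complexBetti (Motives.fiberOver f t) k) :
    IsContinuationAlong γ α β ↔
      transportFun f k hU (s := ⟨s, Set.mem_univ s⟩) (t := ⟨t, Set.mem_univ t⟩)
        ⟦γ.map (continuous_id.subtype_mk fun x ↦ Set.mem_univ x)⟧ α = β := by
  constructor
  · rintro ⟨Γ, hΓ⟩
    exact transportFun_eq_of_path f k hU _ Γ fun u ↦ hΓ u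
  · rintro rfl
    obtain ⟨Γ, hΓ⟩ := exists_path_transportFun f k hU (s := ⟨s, Set.mem_univ s⟩)
      (t := ⟨t, Set.mem_univ t⟩) (γ.map (continuous_id.subtype_mk fun x ↦ Set.mem_univ x)) α
    exact ⟨Γ, fun u ↦ hΓ u⟩

/-- The set of continuations along loops is the range of transport over `π₁` (private copy of
`setOf_isContinuationAlong_eq_range_transportFun`, same reason). [cite: VoisinHodgeI2002, §9.2.1] -/
private theorem setOf_isContinuationAlong_eq_range_transportFun'
    (hU : IsCohomologicallyLocallyTrivialOn f (Set.univ : Set (Motives.ComplexPoints S)))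
    (s : Motives.ComplexPoints S) (α : complexBetti (Motives.fiberOver f s) k) :
    {β : complexBetti (Motives.fiberOver f s) k | ∃ γ : Path s s, IsContinuationAlong γ α β} =
      Set.range fun γ : Path.Homotopic.Quotient
          (⟨s, Set.mem_univ s⟩ : (Set.univ : Set (Motives.ComplexPoints S))) ⟨s, Set.mem_univ s⟩ ↦
        transportFun f k hU γ α := by
  ext β
  constructor
  · rintro ⟨γ, hγ⟩
    exact ⟨_, (isContinuationAlong_iff_transportFun_eq' f k hU γ α β).1 hγ⟩
  · rintro ⟨γ, rfl⟩
    induction γ using Quotient.ind with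
    | _ γ =>
      obtain ⟨Γ, hΓ⟩ := exists_path_transportFun f k hU γ α
      exact ⟨γ.map continuous_subtype_val, Γ, fun u ↦ hΓ u⟩

/-- A class fixed by a finite-index subgroup of `π₁` has finite monodromy orbit (private copy of
`finite_setOf_isContinuationAlong_of_finiteIndex`, same reason). [cite: BaldiKlinglerUllmo2024, §3.2] -/
private theorem finite_setOf_isContinuationAlong_of_finiteIndex'
    (hU : IsCohomologicallyLocallyTrivialOn f (Set.univ : Set (Motives.ComplexPoints S)))
    (s : Motives.ComplexPoints S) (α : complexBetti (Motives.fiberOver f s) k)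
    (H : Subgroup (FundamentalGroup (Set.univ : Set (Motives.ComplexPoints S)) ⟨s, Set.mem_univ s⟩))
    [H.FiniteIndex]
    (hH : ∀ γ ∈ H, transportFun f k hU (FundamentalGroup.toPath γ) α = α) :
    {β : complexBetti (Motives.fiberOver f s) k | ∃ γ : Path s s, IsContinuationAlong γ α β}.Finite := by
  rw [setOf_isContinuationAlong_eq_range_transportFun' f k hU s α]
  set ρ := (localSystemOfRestrict f k hU).monodromyRep ⟨s, Set.mem_univ s⟩
  have hρ : ∀ g, ρ g α = transportFun f k hU (FundamentalGroup.toPath g) α := fun g ↦ rfl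
  refine (Set.finite_range fun q : _ ⧸ H ↦ ρ q.out α).subset ?_
  rintro _ ⟨γ, rfl⟩
  obtain ⟨h, hh⟩ := QuotientGroup.mk_out_eq_mul H (FundamentalGroup.fromPath γ)
  refine ⟨QuotientGroup.mk (FundamentalGroup.fromPath γ), ?_⟩
  change ρ (QuotientGroup.mk (s := H) (FundamentalGroup.fromPath γ)).out α = _
  rw [hh, map_mul, Module.End.mul_apply, hρ h, hH h h.2, hρ]

/-- **The monodromy orbit of a rational class consists of rational classes**: for a smooth
projective family over a quasi-projective base smooth of pure dimension `d`, every flat continuation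
along a path of a rational class `α ∈ Hᵏ(X_s(ℂ); ℂ)` is rational (continuations are transports,
`isContinuationAlong_iff_transportFun_eq`, and transport preserves rationality,
`isRationalClass_transportFun_of_isSmoothProjectiveFamily`). [cite: VoisinHodgeII2003, §3.1.2] -/
theorem IsContinuationAlong.isRationalClass_of_isSmoothProjectiveFamily {n : ℕ} (d : ℕ)
    (hf : Motives.IsSmoothProjectiveFamily f n) (hS : IsQuasiProjectiveOver S)
    [SmoothOfRelativeDimension d S.hom] {s t : Motives.ComplexPoints S} {γ : Path s t}
    {α : complexBetti (Motives.fiberOver f s) k} {β : complexBetti (Motives.fiberOver f t) k}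
    (h : IsContinuationAlong γ α β) (hα : IsRationalClass α) : IsRationalClass β := by
  rw [← (isContinuationAlong_iff_transportFun_eq' f k
    (isCohomologicallyLocallyTrivialOn_univ_of_isSmoothProjectiveFamily f d hf hS) γ α β).1 h]
  exact isRationalClass_transportFun_of_isSmoothProjectiveFamily f k d hf hS _ hα

/-- **The monodromy orbit of an integral class consists of integral classes** (same setting).
[cite: VoisinHodgeI2002, Rem. 10.17] -/
theorem IsContinuationAlong.isIntegralClass_of_isSmoothProjectiveFamily {n : ℕ} (d : ℕ)
    (hf : Motives.IsSmoothProjectiveFamily f n) (hS : IsQuasiProjectiveOver S)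
    [SmoothOfRelativeDimension d S.hom] {s t : Motives.ComplexPoints S} {γ : Path s t}
    {α : complexBetti (Motives.fiberOver f s) k} {β : complexBetti (Motives.fiberOver f t) k}
    (h : IsContinuationAlong γ α β) (hα : IsIntegralClass α) : IsIntegralClass β := by
  rw [← (isContinuationAlong_iff_transportFun_eq' f k
    (isCohomologicallyLocallyTrivialOn_univ_of_isSmoothProjectiveFamily f d hf hS) γ α β).1 h]
  exact isIntegralClass_transportFun_of_isSmoothProjectiveFamily f k d hf hS _ hα

end Orbit

section QbarOrbit

variable {k : Type} [Field k] (σ : k →+* ℂ)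
  {𝒳₀ S₀ : Motives.SchemeOver k} (f₀ : 𝒳₀ ⟶ S₀) {n : ℕ} (p : ℕ)

/-- **The monodromy orbit of a rational class is rational** for the complexification
`f = f₀ ⊗_σ ℂ` of a family over a smooth irreducible quasi-projective `S₀` with `f` smooth
projective: every flat continuation along a path of a rational class `α ∈ Hᵖ(X_s(ℂ); ℂ)` is
rational. [cite: VoisinHodgeII2003, §3.1.2] -/
theorem IsContinuationAlong.isRationalClass_baseChangeHom
    (hf : Motives.IsSmoothProjectiveFamily ((Motives.baseChangeHom σ).map f₀) n)
    (hS₀ : IsQuasiProjectiveOver S₀) [IrreducibleSpace S₀.left] [Smooth S₀.hom]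
    {s t : Motives.ComplexPoints ((Motives.baseChangeHom σ).obj S₀)} {γ : Path s t}
    {α : complexBetti (Motives.fiberOver ((Motives.baseChangeHom σ).map f₀) s) p}
    {β : complexBetti (Motives.fiberOver ((Motives.baseChangeHom σ).map f₀) t) p}
    (h : IsContinuationAlong γ α β) (hα : IsRationalClass α) : IsRationalClass β := by
  obtain ⟨d, hd⟩ := exists_smoothOfRelativeDimension_baseChangeHom σ S₀
  haveI := hd
  exact h.isRationalClass_of_isSmoothProjectiveFamily _ p d hf
    (isQuasiProjectiveOver_baseChangeHom' σ hS₀) hα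

/-- **The monodromy orbit of an integral class is integral** for such a family.
[cite: VoisinHodgeI2002, Rem. 10.17] -/
theorem IsContinuationAlong.isIntegralClass_baseChangeHom
    (hf : Motives.IsSmoothProjectiveFamily ((Motives.baseChangeHom σ).map f₀) n)
    (hS₀ : IsQuasiProjectiveOver S₀) [IrreducibleSpace S₀.left] [Smooth S₀.hom]
    {s t : Motives.ComplexPoints ((Motives.baseChangeHom σ).obj S₀)} {γ : Path s t}
    {α : complexBetti (Motives.fiberOver ((Motives.baseChangeHom σ).map f₀) s) p}
    {β : complexBetti (Motives.fiberOver ((Motives.baseChangeHom σ).map f₀) t) p}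
    (h : IsContinuationAlong γ α β) (hα : IsIntegralClass α) : IsIntegralClass β := by
  obtain ⟨d, hd⟩ := exists_smoothOfRelativeDimension_baseChangeHom σ S₀
  haveI := hd
  exact h.isIntegralClass_of_isSmoothProjectiveFamily _ p d hf
    (isQuasiProjectiveOver_baseChangeHom' σ hS₀) hα

/-- **A class fixed under transport by a finite-index subgroup of `π₁(S(ℂ), s)` has finite monodromy
orbit**, for the complexification `f = f₀ ⊗_σ ℂ` of a family over a smooth irreducible
quasi-projective `S₀` (`k` any field, e.g. `ℚ̄`) with `f` smooth projective: the set of flat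
continuations of `α ∈ Hᵖ(X_s(ℂ); ℂ)` along loops at `s` — the monodromy orbit of the named fact
`bku_finite_monodromyOrbit_of_isHodgeGenericIn` — is finite. This is the formal last step of that
fact's printed proof (Baldi–Klingler–Ullmo §3.2 with André 1992: at a Hodge-generic point a
finite-index subgroup of monodromy lies in the derived Mumford–Tate group, which fixes the Hodge
classes), in exactly its setting (`finite_setOf_isContinuationAlong_of_finiteIndex` with the local
system `isCohomologicallyLocallyTrivialOn_univ_baseChangeHom`; the orbit map factors through the finite
coset space `π₁ / H`). [cite: BaldiKlinglerUllmo2024, §3.2] -/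
theorem finite_setOf_isContinuationAlong_of_finiteIndex_baseChangeHom
    (hf : Motives.IsSmoothProjectiveFamily ((Motives.baseChangeHom σ).map f₀) n)
    (hS₀ : IsQuasiProjectiveOver S₀) [IrreducibleSpace S₀.left] [Smooth S₀.hom]
    (s : Motives.ComplexPoints ((Motives.baseChangeHom σ).obj S₀))
    (α : complexBetti (Motives.fiberOver ((Motives.baseChangeHom σ).map f₀) s) p)
    (H : Subgroup (FundamentalGroup
      (Set.univ : Set (Motives.ComplexPoints ((Motives.baseChangeHom σ).obj S₀))) ⟨s, Set.mem_univ s⟩))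
    [H.FiniteIndex]
    (hH : ∀ γ ∈ H, transportFun ((Motives.baseChangeHom σ).map f₀) p
      (isCohomologicallyLocallyTrivialOn_univ_baseChangeHom σ f₀ hf hS₀)
      (FundamentalGroup.toPath γ) α = α) :
    {β : complexBetti (Motives.fiberOver ((Motives.baseChangeHom σ).map f₀) s) p |
        ∃ γ : Path s s, IsContinuationAlong γ α β}.Finite :=
  finite_setOf_isContinuationAlong_of_finiteIndex' _ p _ s α H hH

end QbarOrbit

end HodgeTheory

end Literature.AlgebraicGeometry.HodgeTheory

end
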